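import Summits.Schanuel.Schanuel.Theorems.RootDecomp1KTHLayerCell04
import Summits.Schanuel.Schanuel.Theses.RootDecomp1K
import Summits.Schanuel.Schanuel.Theses.DiophantineCore

/-!
# RootDecomp1KTHLayerCell — lens 1, generation 40 «THE (T.H.) LAYER OF 33364: ORDER GRADING + LIOUVILLE TRANSCENDENCE-TYPE MEASURE + DIAZ RUNGS ON THE MOMENT CURVE» — continuation (RootDecomp1KTHLayerCell05): §7 LIVE bridges (port addition per critic VERDICT L1866): `Iff.rfl` read-backs of stmt-Schanuel-33364 / stmt-Schanuel-3816 and `F₀ ⟸ 3816` against the live decls — the ONLY part importing the Theses files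

(lens-1 g40 `RootDecomp1KTHLayerCell.lean` [HOME/decomp-schanuel-lens-1/g40/ sha256 b5224e65…a9df, 1031 l; NODE L1861 / REQUEST L1862; critic VERDICT L1866 (CLEARED, ONE THEOREM credit, RULE K-R27, port GO)]; port by census-1 gen 17 as
`RootDecomp1KTHLayerCell01`–`04` — see the PORT NOTE of part 01; `--supports stmt-Schanuel-33364`; rung 0.)
-/

noncomputable section

open Complex Polynomial IntermediateField Filter Asymptotics LiouvilleNumber
open scoped Nat Topology

namespace Summit.Schanuel.Schanuel.Theorems.RootDecomp1KTHLayer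

/-! ## §7 The LIVE items read back (port addition; critic VERDICT L1866): `F₀ ⟸ 3816` against the live decls

The route files `Theses.RootDecomp1K` / `Theses.DiophantineCore` are imported in THIS part only; the two
`Iff.rfl` bridges are the HOME probe's P0 / P0′ (THprobe.lean e690f2fc…, ll. 1045 / 1051) moved to the tree, so
that the reduction `THLayer ⟸ SchanuelUnderTH` (stmt-Schanuel-3816, OPEN) and the grading of
`FiniteOrderLiouvilleSchanuel` (stmt-Schanuel-33364, OPEN) are recorded against the LIVE declarations.
Nothing here proves either item; rung 0. -/

section LiveBridges

/-- P0 — READ-BACK: the LIVE item 33364 (`Theses.RootDecomp1K.FiniteOrderLiouvilleSchanuel`) IS, definitionally,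
the text `Item33364` graded in §1. -/
theorem finiteOrderLiouvilleSchanuel_iff_item33364 :
    Summit.Schanuel.Schanuel.Theses.RootDecomp1K.FiniteOrderLiouvilleSchanuel ↔ Item33364 :=
  Iff.rfl

/-- P0′ — READ-BACK: the LIVE item 3816 (`Theses.DiophantineCore.SchanuelUnderTH`, (T.H.) inline; its source text
`(|h i| : ℝ)` elaborates to `|(h i : ℝ)|`) IS, definitionally, the text `UnderTH` of §1. -/
theorem schanuelUnderTH_iff_underTH :
    Summit.Schanuel.Schanuel.Theses.DiophantineCore.SchanuelUnderTH ↔ UnderTH :=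
  Iff.rfl

/-- The ORDER GRADING of the LIVE item 33364: `FiniteOrderLiouvilleSchanuel ↔ PosLayer ∧ THLayer`. -/
theorem finiteOrderLiouvilleSchanuel_iff_layers :
    Summit.Schanuel.Schanuel.Theses.RootDecomp1K.FiniteOrderLiouvilleSchanuel ↔ PosLayer ∧ THLayer :=
  finiteOrderLiouvilleSchanuel_iff_item33364.trans item33364_iff_layers

/-- **`F₀ ⟸ 3816` against the LIVE decl**: `SchanuelUnderTH` (stmt-Schanuel-3816, OPEN) implies the whole
(T.H.)-layer `THLayer` of 33364 — a REDUCTION, nothing is decided. -/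
theorem thLayer_of_schanuelUnderTH
    (h3816 : Summit.Schanuel.Schanuel.Theses.DiophantineCore.SchanuelUnderTH) : THLayer :=
  thLayer_of_underTH (schanuelUnderTH_iff_underTH.mp h3816)

/-- With `F₀` supplied by the LIVE 3816, the LIVE 33364 is equivalent to its positive-order layer `F₊` alone:
`SchanuelUnderTH → (FiniteOrderLiouvilleSchanuel ↔ PosLayer)`. -/
theorem finiteOrderLiouvilleSchanuel_iff_posLayer_of_schanuelUnderTH
    (h3816 : Summit.Schanuel.Schanuel.Theses.DiophantineCore.SchanuelUnderTH) :
    Summit.Schanuel.Schanuel.Theses.RootDecomp1K.FiniteOrderLiouvilleSchanuel ↔ PosLayer :=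
  finiteOrderLiouvilleSchanuel_iff_layers.trans
    ⟨fun h => h.1, fun hP => ⟨hP, thLayer_of_schanuelUnderTH h3816⟩⟩

end LiveBridges

end Summit.Schanuel.Schanuel.Theorems.RootDecomp1KTHLayer

end
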